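import Literature.AnabelianGeometry.Anabelioids.InductionStar
import Literature.AnabelianGeometry.Anabelioids.FiberFunctorUnique
import Mathlib.Topology.Algebra.ClopenNhdofOne
import Mathlib.CategoryTheory.Galois.Topology
import HarnessLib

/-!
# Anabelioids: the fundamental group of `B(G)` is `G` ([GeoAn] §1.1)

Mochizuki, *The geometry of anabelioids*, Publ. RIMS **40** (2004), §1.1, p. 9–10
[cite: MochizukiGeoAn2004, §1.1 p.9]: for a profinite group `G`, `B(G)` (finite sets with continuous
`G`-action) is a connected anabelioid whose fundamental group — the automorphism group of the
(forgetful) basepoint — "is" `G`.  In the tree `B(G) = BCat G = ContAction FintypeCat G`, its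
forgetful fibre functor is `ObjectProperty.ι _ ⋙ Action.forget FintypeCat G` (t5's
`galoisCategory_bCat`), and `π₁` of a morphism is `pi1Map`.  PROVED here (theorems only):

* `exists_continuousMulEquiv_aut_forget` — for `G` compact Hausdorff totally disconnected there is
  an isomorphism of topological groups `e : G ≃ₜ* Aut (forget)` with `(e g)_X = ρ_X(g)` (the
  action of `g` on every finite continuous `G`-set): injective because the coset objects `G/N`
  (`N` open normal) separate points, surjective because an automorphism of the forgetful functor is
  determined, by naturality along the orbit maps `G/N → X` (`Induction.orbitHom`), by the
  compatible family of its values at the base points of the `G/N`, which a compactness argument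
  lifts to an element of `G`; continuous since stabilisers are open;
* `aut_forget_eq_of_app_eq` — such an `e` is unique (any automorphism is determined by its
  components), and the DICTIONARY for restriction functors: `pi1Map (ContAction.res φ)` carries
  `e_H h` to the automorphism acting by `φ h` (`pi1Map_res_app`), whence
  `isPi1Mono_res_iff_injective : IsPi1Mono (res φ) ↔ φ injective` (given that the forgetful functor
  of `B(H)` is a fibre functor).

Proof-only file (no definitions).
-/

noncomputable section

namespace Literature.AnabelianGeometry.Anabelioids

open CategoryTheory CategoryTheory.Limits CategoryTheory.PreGaloisCategory
open Literature.AlgebraicGeometry.Frobenioids (BCat)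
open scoped Pointwise Topology FintypeCatDiscrete
open Induction

universe u

section

variable {G : Type u} [Group G] [TopologicalSpace G] [IsTopologicalGroup G]

/-- Naturality of an automorphism of the forgetful basepoint along an orbit map `G/N → X`:
`σ_X(x) = o(σ_{G/N}(eN))`. [folklore] -/
private theorem aut_app_eq_orbit (σ : Aut (ObjectProperty.ι (Action.IsContinuous (V := FintypeCat.{u}) (G := G)) ⋙
      Action.forget FintypeCat.{u} G)) (X : BCat G) (x : X.obj.V) (N : Subgroup G)
    [Finite (G ⧸ N)] (hN : IsOpen (N : Set G)) (hle : N ≤ MulAction.stabilizer G x) (g : G)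
    (hg : ((g : G ⧸ N) : (quotObj N hN).obj.V) = (σ.hom.app (quotObj N hN)).hom (basePt N hN)) :
    (σ.hom.app X).hom x = g • x := by
  have nat := σ.hom.naturality (orbitHom X x N hN hle)
  have h := ConcreteCategory.congr_hom nat (basePt N hN)
  change (σ.hom.app X).hom ((orbitHom X x N hN hle).hom.hom (((1 : G) : G ⧸ N) : _)) =
    (orbitHom X x N hN hle).hom.hom ((σ.hom.app (quotObj N hN)).hom (basePt N hN)) at h
  rw [orbitHom_mk, one_smul, ← hg, orbitHom_mk] at h
  exact h

/-- **`π₁(B(G)) = G`** ([GeoAn] §1.1): for a profinite group `G`, the action homomorphism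
`G → Aut(forget : B(G) → FinSets)`, `g ↦ (ρ_X(g))_X`, is an isomorphism of topological groups.
[cite: MochizukiGeoAn2004, §1.1 p.9] -/
theorem exists_continuousMulEquiv_aut_forget [CompactSpace G] [T2Space G]
    [TotallyDisconnectedSpace G] :
    ∃ e : G ≃ₜ* Aut (ObjectProperty.ι (Action.IsContinuous (V := FintypeCat.{u}) (G := G)) ⋙
      Action.forget FintypeCat.{u} G), ∀ (g : G) (X : BCat G), (e g).hom.app X = X.obj.ρ g := by
  classical
  -- (a) the action homomorphism
  let ι : G → Aut (ObjectProperty.ι (Action.IsContinuous (V := FintypeCat.{u}) (G := G)) ⋙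
      Action.forget FintypeCat.{u} G) := fun g =>
    NatIso.ofComponents (fun X => Action.ρAut X.obj g) (fun {X Y} f => (f.hom.comm g).symm)
  have hι : ∀ (g : G) (X : BCat G), (ι g).hom.app X = X.obj.ρ g := fun g X => rfl
  let ρ : G →* Aut (ObjectProperty.ι (Action.IsContinuous (V := FintypeCat.{u}) (G := G)) ⋙
      Action.forget FintypeCat.{u} G) :=
    { toFun := ι
      map_one' := by
        apply Iso.ext
        apply NatTrans.ext
        funext X
        change X.obj.ρ 1 = 𝟙 _
        rw [map_one]
        rfl
      map_mul' := fun g h => by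
        apply Iso.ext
        apply NatTrans.ext
        funext X
        change X.obj.ρ (g * h) = X.obj.ρ h ≫ X.obj.ρ g
        rw [map_mul]
        rfl }
  have hρ : ∀ (g : G) (X : BCat G), (ρ g).hom.app X = X.obj.ρ g := fun g X => rfl
  -- finiteness of the coset spaces by open normal subgroups
  have fin : ∀ N : OpenNormalSubgroup G, Finite (G ⧸ N.toSubgroup) := fun N =>
    Subgroup.quotient_finite_of_isOpen _ N.isOpen'
  -- (b) injectivity: the coset objects separate points
  have hinj : Function.Injective ρ := by
    rw [injective_iff_map_eq_one]
    intro g hg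
    by_contra hne
    obtain ⟨N, hN⟩ := ProfiniteGrp.exist_openNormalSubgroup_sub_open_nhds_of_one
      (isOpen_compl_singleton (x := g)) (by simpa using fun e => hne e.symm)
    haveI := fin N
    have h1 := congrArg (fun σ : Aut (ObjectProperty.ι (Action.IsContinuous (V := FintypeCat.{u}) (G := G)) ⋙
      Action.forget FintypeCat.{u} G) => σ.hom.app (quotObj N.toSubgroup N.isOpen')) hg
    have h2 := ConcreteCategory.congr_hom h1 (basePt N.toSubgroup N.isOpen')
    change ((quotObj N.toSubgroup N.isOpen').obj.ρ g).hom (basePt N.toSubgroup N.isOpen') =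
      basePt N.toSubgroup N.isOpen' at h2
    change (((g * 1 : G)) : G ⧸ N.toSubgroup) = (((1 : G)) : G ⧸ N.toSubgroup) at h2
    rw [mul_one, QuotientGroup.eq, mul_one, inv_mem_iff] at h2
    exact hN h2 rfl
  -- (c) surjectivity
  have hsurj : Function.Surjective ρ := by
    intro σ
    let γ : ∀ N : OpenNormalSubgroup G, G ⧸ N.toSubgroup := fun N =>
      haveI := fin N
      (σ.hom.app (quotObj N.toSubgroup N.isOpen')).hom (basePt N.toSubgroup N.isOpen')
    -- the closed cosets `C N = {g | gN = γ N}`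
    let C : OpenNormalSubgroup G → Set G := fun N =>
      (fun g => (γ N).out⁻¹ * g) ⁻¹' (N : Set G)
    have hCmem : ∀ (N : OpenNormalSubgroup G) (g : G),
        g ∈ C N ↔ (g : G ⧸ N.toSubgroup) = γ N := by
      intro N g
      change (γ N).out⁻¹ * g ∈ N.toSubgroup ↔ _
      rw [← QuotientGroup.eq, QuotientGroup.out_eq']
      exact ⟨Eq.symm, Eq.symm⟩
    have hCclosed : ∀ N, IsClosed (C N) := fun N =>
      N.toOpenSubgroup.isClosed.preimage (continuous_const_mul _)
    have hCne : ∀ N, (C N).Nonempty := fun N =>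
      ⟨(γ N).out, (hCmem N _).2 (QuotientGroup.out_eq' _)⟩
    -- compatibility of the `γ N`: directedness of the cosets
    have hCdir : Directed (fun s t : Set G => s ⊇ t) C := by
      intro N₁ N₂
      refine ⟨N₁ ⊓ N₂, ?_, ?_⟩
      · intro g hg
        rw [hCmem] at hg ⊢
        haveI := fin N₁
        haveI := fin (N₁ ⊓ N₂)
        have hle : (N₁ ⊓ N₂).toSubgroup ≤
            MulAction.stabilizer G (basePt N₁.toSubgroup N₁.isOpen') := by
          intro n hn
          rw [MulAction.mem_stabilizer_iff]
          change (((n * 1 : G)) : G ⧸ N₁.toSubgroup) = (((1 : G)) : G ⧸ N₁.toSubgroup)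
          rw [mul_one, QuotientGroup.eq, mul_one, inv_mem_iff]
          exact hn.1
        have := aut_app_eq_orbit σ (quotObj N₁.toSubgroup N₁.isOpen')
          (basePt N₁.toSubgroup N₁.isOpen') (N₁ ⊓ N₂).toSubgroup (N₁ ⊓ N₂).isOpen' hle g hg
        change (g : G ⧸ N₁.toSubgroup) =
          (σ.hom.app (quotObj N₁.toSubgroup N₁.isOpen')).hom (basePt N₁.toSubgroup N₁.isOpen')
        rw [this]
        change (g : G ⧸ N₁.toSubgroup) = (((g * 1 : G)) : G ⧸ N₁.toSubgroup)
        rw [mul_one]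
      · intro g hg
        rw [hCmem] at hg ⊢
        haveI := fin N₂
        haveI := fin (N₁ ⊓ N₂)
        have hle : (N₁ ⊓ N₂).toSubgroup ≤
            MulAction.stabilizer G (basePt N₂.toSubgroup N₂.isOpen') := by
          intro n hn
          rw [MulAction.mem_stabilizer_iff]
          change (((n * 1 : G)) : G ⧸ N₂.toSubgroup) = (((1 : G)) : G ⧸ N₂.toSubgroup)
          rw [mul_one, QuotientGroup.eq, mul_one, inv_mem_iff]
          exact hn.2
        have := aut_app_eq_orbit σ (quotObj N₂.toSubgroup N₂.isOpen')
          (basePt N₂.toSubgroup N₂.isOpen') (N₁ ⊓ N₂).toSubgroup (N₁ ⊓ N₂).isOpen' hle g hg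
        change (g : G ⧸ N₂.toSubgroup) =
          (σ.hom.app (quotObj N₂.toSubgroup N₂.isOpen')).hom (basePt N₂.toSubgroup N₂.isOpen')
        rw [this]
        change (g : G ⧸ N₂.toSubgroup) = (((g * 1 : G)) : G ⧸ N₂.toSubgroup)
        rw [mul_one]
    haveI : Nonempty (OpenNormalSubgroup G) :=
      ⟨{ toOpenSubgroup := ⊤, isNormal' := ⟨fun n _ g => Subgroup.mem_top _⟩ }⟩
    obtain ⟨g, hg⟩ := IsCompact.nonempty_iInter_of_directed_nonempty_isCompact_isClosed C hCdir
      hCne (fun N => (hCclosed N).isCompact) hCclosed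
    rw [Set.mem_iInter] at hg
    refine ⟨g, ?_⟩
    apply Iso.ext
    apply NatTrans.ext
    funext X
    apply FintypeCat.hom_ext
    intro x
    change X.obj.V at x
    change (X.obj.ρ g).hom x = (σ.hom.app X).hom x
    -- an open normal subgroup inside the (open) stabiliser of `x`
    have hSx : IsOpen (MulAction.stabilizer G x : Set G) := (isContinuous_iff X.obj).mp X.property x
    obtain ⟨N, hN⟩ := ProfiniteGrp.exist_openNormalSubgroup_sub_open_nhds_of_one hSx
      (MulAction.stabilizer G x).one_mem
    haveI := fin N
    have hle : N.toSubgroup ≤ MulAction.stabilizer G x := fun n hn => hN hn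
    exact (aut_app_eq_orbit σ X x N.toSubgroup N.isOpen' hle g ((hCmem N g).1 (hg N))).symm
  -- (d) continuity: stabilisers are open
  have hcont : Continuous ρ := by
    refine continuous_induced_rng.2 (continuous_pi fun X => ?_)
    refine continuous_discrete_rng.2 fun b => ?_
    rw [isOpen_iff_forall_mem_open]
    intro g₀ hg₀
    -- the kernel of the action on `X` is open
    let K : Set G := ⋂ x : X.obj.V, (MulAction.stabilizer G x : Set G)
    have hK : IsOpen K :=
      isOpen_iInter_of_finite fun x => (isContinuous_iff X.obj).mp X.property x
    refine ⟨(fun k => g₀ * k) '' K, ?_, isOpenMap_mul_left g₀ _ hK, ⟨1, ?_, mul_one g₀⟩⟩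
    · rintro _ ⟨k, hk, rfl⟩
      have hk' : ∀ x : X.obj.V, k • x = x := fun x => by
        have := Set.mem_iInter.mp hk x
        exact this
      have hk1 : X.obj.ρ k = 1 := by
        apply FintypeCat.hom_ext
        intro x
        exact hk' x
      have key : autEmbedding (ObjectProperty.ι (Action.IsContinuous (V := FintypeCat.{u}) (G := G)) ⋙
      Action.forget FintypeCat.{u} G) (ρ (g₀ * k)) X = autEmbedding (ObjectProperty.ι (Action.IsContinuous (V := FintypeCat.{u}) (G := G)) ⋙
      Action.forget FintypeCat.{u} G) (ρ g₀) X := by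
        apply Iso.ext
        change (ρ (g₀ * k)).hom.app X = (ρ g₀).hom.app X
        rw [hρ, hρ, map_mul, hk1, mul_one]
      have hb : autEmbedding (ObjectProperty.ι (Action.IsContinuous (V := FintypeCat.{u}) (G := G)) ⋙
      Action.forget FintypeCat.{u} G) (ρ g₀) X = b := hg₀
      change autEmbedding (ObjectProperty.ι (Action.IsContinuous (V := FintypeCat.{u}) (G := G)) ⋙
      Action.forget FintypeCat.{u} G) (ρ (g₀ * k)) X ∈ ({b} : Set _)
      rw [key, hb]
      exact Set.mem_singleton b
    · exact Set.mem_iInter.mpr fun x => (MulAction.stabilizer G x).one_mem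
  -- (e) assembly
  let e₀ : G ≃* Aut (ObjectProperty.ι (Action.IsContinuous (V := FintypeCat.{u}) (G := G)) ⋙
      Action.forget FintypeCat.{u} G) := MulEquiv.ofBijective ρ ⟨hinj, hsurj⟩
  have he₀ : Continuous e₀ := hcont
  let eₜ : G ≃ₜ Aut (ObjectProperty.ι (Action.IsContinuous (V := FintypeCat.{u}) (G := G)) ⋙
      Action.forget FintypeCat.{u} G) := Continuous.homeoOfEquivCompactToT2 (f := e₀.toEquiv) he₀
  exact ⟨{ e₀ with continuous_toFun := he₀, continuous_invFun := eₜ.symm.continuous },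
    fun g X => rfl⟩

omit [IsTopologicalGroup G] in
/-- An automorphism of the forgetful basepoint of `B(G)` is determined by its components; in
particular the isomorphism of `exists_continuousMulEquiv_aut_forget` is unique.
[cite: MochizukiGeoAn2004, §1.1 p.9] -/
theorem aut_forget_eq_of_app_eq (σ τ : Aut (ObjectProperty.ι (Action.IsContinuous (V := FintypeCat.{u}) (G := G)) ⋙
      Action.forget FintypeCat.{u} G)) (h : ∀ X : BCat G, σ.hom.app X = τ.hom.app X) :
    σ = τ :=
  Iso.ext (NatTrans.ext (funext h))

end

/-! ### The dictionary for restriction functors -/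

section Res

variable {G H : Type u} [Group G] [TopologicalSpace G] [IsTopologicalGroup G]
  [Group H] [TopologicalSpace H] [IsTopologicalGroup H] (φ : H →ₜ* G)

omit [IsTopologicalGroup G] [IsTopologicalGroup H] in
/-- `π₁` of the restriction functor `B(G) → B(H)` along `φ : H → G` sends the automorphism "act
by `h`" of the forgetful basepoint of `B(H)` to "act by `φ h`" on every finite continuous `G`-set.
[cite: MochizukiGeoAn2004, Def. 1.1.2(ii) p.10] -/
theorem pi1Map_res_app (σ : Aut (ObjectProperty.ι (Action.IsContinuous (V := FintypeCat.{u}) (G := H)) ⋙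
      Action.forget FintypeCat.{u} H)) (h : H) (hσ : ∀ Y : BCat H, σ.hom.app Y = Y.obj.ρ h)
    (X : BCat G) :
    (pi1Map (ContAction.res FintypeCat.{u} φ) (ObjectProperty.ι (Action.IsContinuous (V := FintypeCat.{u}) (G := H)) ⋙
      Action.forget FintypeCat.{u} H) σ).hom.app X = X.obj.ρ (φ h) := by
  rw [pi1Map_hom_app, hσ]
  rfl

/-- **Dictionary**: for profinite `G`, `H` and a continuous homomorphism `φ : H → G`, the
restriction functor `B(G) → B(H)` is a `π₁`-monomorphism if and only if `φ` is injective
(`π₁(B(H)) = H`, `π₁(B(G)) = G` and `π₁(res φ) = φ` under these identifications); stated with the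
forgetful basepoint of `B(H)` assumed to be a fibre functor (t5's `galoisCategory_bCat`).
[cite: MochizukiGeoAn2004, Rem. 1.2.2.1 p.17] -/
theorem isPi1Mono_res_iff_injective [CompactSpace G] [T2Space G] [TotallyDisconnectedSpace G]
    [CompactSpace H] [T2Space H] [TotallyDisconnectedSpace H] [GaloisCategory (BCat H)]
    [FiberFunctor (ObjectProperty.ι (Action.IsContinuous (V := FintypeCat.{u}) (G := H)) ⋙
      Action.forget FintypeCat.{u} H)] :
    IsPi1Mono (ContAction.res FintypeCat.{u} φ) ↔ Function.Injective φ := by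
  obtain ⟨eG, heG⟩ := exists_continuousMulEquiv_aut_forget (G := G)
  obtain ⟨eH, heH⟩ := exists_continuousMulEquiv_aut_forget (G := H)
  rw [isPi1Mono_iff_injective (ContAction.res FintypeCat.{u} φ) (ObjectProperty.ι (Action.IsContinuous (V := FintypeCat.{u}) (G := H)) ⋙
      Action.forget FintypeCat.{u} H)]
  -- components of `π₁(res φ)(e_H h)` are `ρ_X(φ h)`
  have happ : ∀ (h : H) (X : BCat G),
      (pi1Map (ContAction.res FintypeCat.{u} φ) (ObjectProperty.ι (Action.IsContinuous (V := FintypeCat.{u}) (G := H)) ⋙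
      Action.forget FintypeCat.{u} H) (eH h)).hom.app X = X.obj.ρ (φ h) :=
    fun h X => pi1Map_res_app φ (eH h) h (heH h) X
  constructor
  · intro hinj h h' hh
    apply eH.injective
    apply hinj
    apply Iso.ext
    apply NatTrans.ext
    funext X
    rw [happ, happ, hh]
  · intro hinj σ σ' hσ
    obtain ⟨h, rfl⟩ := eH.surjective σ
    obtain ⟨h', rfl⟩ := eH.surjective σ'
    have hG : eG (φ h) = eG (φ h') := by
      apply Iso.ext
      apply NatTrans.ext
      funext X
      rw [heG, heG]
      have := congrArg (fun τ => τ.hom.app X) hσ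
      simp only [happ] at this
      exact this
    rw [hinj (eG.injective hG)]

end Res

end Literature.AnabelianGeometry.Anabelioids

end
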